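import Mathlib
import HarnessLib
import HarnessLib.Audit
import Summits.Langlands.Statement
import Literature.NumberTheory.GaloisRepresentations.LocalGaloisGroupFrobeniusProofs
import Literature.NumberTheory.Automorphic.LocalConstantsProofs
import Literature.NumberTheory.Automorphic.LocalLanglandsGLProofs
import HarnessLib.Audit.Status.Attr

/-!
Route: LiftDescend

Route LiftDescend — "reciprocity = (A) over CM in all weights + ascent of (A) + potential automorphy
+ descent".

It suffices to show X = X₁ ∧ X₂ ∧ X₃ ∧ X₄ where
 X₁ (AutToGalCM): direction (A) — Galois representations with full local–global compatibility — for
EVERY L-algebraic cuspidal π of GL_n over every CM field (the irregular sector being the open core);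
 X₂ (AscentAutToGal): (A) over all totally real and CM fields ⇒ (A) over every number field
(restriction of scalars: automorphic induction to the maximal totally real subfield,
irregular-weight Galois representations there, de-induction/descent);
 X₃ (PotentialAutomorphy, rev-11 repair: jointly ∃𝓡-pinned, summit-shaped): if (A) holds over F for
some reciprocity data, then there are reciprocity data 𝓡 over F carrying (A) for which every
irreducible 𝓡-geometric ρ : Γ_F → GL_n(ℚ̄_ℓ) becomes weakly cuspidal-automorphic over some finite
Galois F′/F on which it stays irreducible (the old ∀𝓡-form under (A)_𝓡 alone was refuted-misstated
on paper: a permissive placeholder p-adic Hodge datum inherits (A) and makes a non-Hodge–Tate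
character 'geometric');
 X₄ (DescentOfAutomorphy): given (A) over F, weak cuspidal automorphy descends along every finite
Galois F′/F (solvable layers: theorem-level; insoluble layers: the crux).
Glue (theorem-level support): (A) over CM ⇒ (A) over totally real (Sorensen patching over
imaginary-quadratic composita); weak (B) + (A) ⇒ (B) w.r.t. the same 𝓡 (Chebotarev–Brauer–Nesbitt +
conjugation transport).

One-line Lean Prop (decls of the route file Summits/Langlands/Langlands/Theses/LiftDescend.lean, all
elaborated in the planner's Sketch.lean, rc 0):
X := LiftDescend.AutToGalCM ∧ LiftDescend.AscentAutToGal ∧ LiftDescend.PotentialAutomorphy ∧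
LiftDescend.DescentOfAutomorphy
over the accepted summit API only: Summit.Langlands.{ReciprocityData, AutomorphicToGalois,
GaloisToAutomorphic, IsGeometricFramed, SatakeFrobCompatibleAt},
Literature.NumberTheory.Automorphic.{isCompact_glFiniteIntegralLevel, CuspidalAutomorphicRepData,
AutomorphicRepData.IsLAlgebraic}, Literature.NumberTheory.GaloisRepresentations.{FramedGaloisRep,
FramedGaloisRep.restrictField, ContinuousRep.IsIrreducible}, Mathlib NumberField.IsCMField /
NumberField.IsTotallyReal / IsGalois / IsSolvable / PadicAlgCl.
Assembly = deciding theorem `closes`: AutToGalCM → AutToGalCMtoTR → AscentAutToGal →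
PotentialAutomorphy → DescentOfAutomorphy → WeakToStrongGalToAut → Langlands (pure logic: ascent
gives (A) over F for some data, PotentialAutomorphy re-chooses data 𝓡 with (A) ∧ potential
automorphy, descent and weak⇒strong run at that 𝓡; gate-certified native, axioms
propext/Classical.choice/Quot.sound).

Rationale: WHY THIS LINE. This is the mainstream automorphy-lifting paradigm (Taylor–Wiles–Kisin,
Calegari–Geraghty, BLGGT, ACC+GHLNSTT) organised CRUX-FIRST by what it does NOT yet reach, with the
logical glue made explicit so that partial results attach as support items. Two structural facts
drive the decomposition: (i) subfields of CM fields are TR or CM, so potential automorphy can never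
leave TR∪CM and every field of mixed signature must be reached by restriction of scalars to its
maximal totally real subfield, where strong purity makes the induced object Hodge-IRREGULAR — the
base-field problem is an instance of the irregular-weight problem (card conjugation-solvable-fields,
refuter audit 2026-08-15); (ii) DESCENT DUALITY: along a cyclic layer, descending automorphy (B)
uses (A) over the base (Π^σ≅Π ⇒ Π=BC(π) ⇒ ρ≅ρ_π⊗χ, BLGGT §5), while descending a Galois
representation (A) uses (B) over the base (ρ_E extends since H²(C_p,ℚ̄_ℓ^×)=0; ρ₀ geometric ⇒
automorphic π₀ ⇒ BC(π₀)=BC(π) ⇒ π₀=π⊗χ^i by Arthur–Clozel fibres) — so every (B)-side crux is stated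
CONDITIONALLY on (A) for the same reciprocity data 𝓡, which also removes the junk-𝓡 vacuity of
unconditional (B)-statements (AUDIT.md §Vacuity). Imported areas: Galois cohomology/patching of
representations (Sorensen's lemma, PROVED in the tree:
Literature.NumberTheory.GaloisRepresentations.PatchingLemma), trace-formula base change
(ArthurClozelAMS120, tree facts ArthurClozel1989_*), p-adic Hodge theory only through the summit's
data. Sources: HarrisLanTaylorThorneRMS2016, Scholze2015, VarmaFMS2024, BarnetlambEtAl2014,
ACCGHLNSTT2023, Taylor2006, CalegariGeraghty2017, Calegari2023, Sorensen2020, Getz2012Nonsolvable,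
Rajan MRL 9 (2002) doi:10.4310/mrl.2002.v9.n4.a9.

RANKED CRUXES. #2 AutToGalCM — (A) over CM fields in ALL weights (irregular = open core; shared with
route CMFern). #3 PotentialAutomorphy — given (A) over F for some data, ∃ reciprocity data 𝓡 with
(A)_𝓡 ∧ every irreducible 𝓡-geometric ρ potentially cuspidal-automorphic (rev 11: jointly ∃𝓡-pinned
after the ∀𝓡-form was refuted-misstated by a permissive placeholder datum; known sectors: regular
polarizable / regular generic over CM; open: irregular HT weights, mixed-signature F, small residual
image). #4 AscentAutToGal — (A) ascends TR∪CM → all F (AI along F/F^tr; non-normal descent ambiguity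
at inert places; simple-group AI for insoluble closures). #5 DescentOfAutomorphy — descent of
automorphy along arbitrary finite Galois F′/F given (A) (solvable: support item, theorem-level;
insoluble: SolvableImage barrier). Support (rank 9, theorem-level or provable now): AutToGalCMtoTR
(Sorensen), SolvableDescentOfAutomorphy (AC+Clifford+Chebotarev), WeakToStrongGalToAut (glue),
LArithmeticOfAutToGal (hidden arithmeticity of the ∀ι statement, card
forall-iota-hidden-arithmeticity H1). Assembly rank 1.

KILL CRITERIA. An L-algebraic cuspidal π over a CM field with a provably transcendental Satake
parameter refutes #2 (and the summit). A finite-group counterexample to the Clifford bookkeeping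
does NOT refute #4/#5 (they are implied by the summit); they die only with the summit over the
relevant fields. If #3 is shown to REQUIRE insoluble F′ for some ρ while #5's insoluble case is
refuted in a model situation, the line (potential ⇒ actual) is dead and the route closes in favour
of CMFern.

NOT DECOMPOSED YET. The irregular core inside #2 (Maass-type vs coherent/limit-of-discrete-series
sector); LGC at v∣ℓ and monodromy at v∤ℓ for HLTT representations (would be support items under #2:
A'Campo, Caraiani–Newton, Varma, card eisenstein-degeneration-monodromy); residually reducible ρ in
#3 (Skinner–Wiles/ANT/FKP); the Brauer-quotient analytic substitute for #5 (card
analytic-descent-pole-tolerant-converse). Splits wait for a closure.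

CHEAPEST FALSIFIER. For #3 as re-typed (rev 11): n = 1 over ℚ — the witness datum 𝓡 must make
geometric exactly the characters matched a.e. by type-A₀ Hecke characters (locally algebraic
⟨κ⟩^k·finite), so any proposed datum admitting ⟨κ⟩^s with s ∉ ℤ, or failing de Rhamness of a Hecke
character's ℓ-adic avatar, is dead on arrival (refuter check in minutes; this is the check that
killed the ∀𝓡-form). For the line as a whole: an irreducible ρ all of whose potentially-automorphic
fields F′ in reach are insoluble over F, together with a refutation of #5's insoluble model case
(see KILL CRITERIA).

NOVELTY (summary; full text in the Novelty field). Nearest prior art: the BLGGT/ACC+ programme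
itself (BarnetlambEtAl2014 §4–5, ACCGHLNSTT2023 §6) and the in-house card
conjugation-solvable-fields (new-combination). Delta: the descent-duality observation forcing
(A)-conditional (B)-cruxes, and the precise typed separation PotentialAutomorphy /
DescentOfAutomorphy / AscentAutToGal with theorem-level glue isolated as support. Expected grade:
variant-to-new-combination (organisation, not mechanism).

BARRIERS (summary; full text in the Barriers field). NonRegularWeightBarrier and
ShimuraVarietyRealizationBarrier bite on #2/#4 and are NOT evaded (relocated: base field ⇒ irregular
weight over F^tr); TaylorWilesNumericalCoincidence(+Narrow), PatchingLocalComponentBarrier,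
ResiduallyReducibleBarrier, ModPLanglandsGL2BeyondQp(+FpBar) bite on #3;
SolvableImageBarrier(+Narrow) is exactly #5's insoluble case and #4's residual class;
TwistedEndoscopySelfDual: evaded for cyclic layers (Arthur–Clozel is not θ-twisted endoscopy), met
again inside #3's polarizable engines; ShtukaConstantFieldBarrier not engaged.

Novelty: NOVELTY (survey 2026-08-15; searches actually run this session: `lit frontier Langlands --since
2021` (30 descendants read: arXiv:2603.19768 irreducibility/monodromy for GL(4), arXiv:2605.03519
infinitesimal characters of completed cohomology of GL_n over CM, arXiv:2502.10799 images — none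
treats descent of automorphy along insoluble extensions or (A)-conditional (B)); `lit search`/`lit
vsearch` UNAVAILABLE (rc 75, retried 3× over the session — refuter must re-run: "image and fibres of
solvable base change Rajan", "descent of Galois representations cyclic base change automorphy",
"potential automorphy nonsolvable descent"); `lean search` over the tree
(PatchingLemma/SorensenPatching proved; exists_baseChange_cyclic;
ArthurClozel1989_cuspidal_descent/_fibres_of_baseChange; exists_galoisRep_of_regularAlgebraic;
FontaineMazurLanglandsGLn); the barrier catalogue (all 13 Langlands entries read); the in-house
cards conjugation-solvable-fields (refuter grade new-combination, audit cites Rajan MRL 2002 Thms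
1–2 and Arthur–Clozel Ch.3 Prop 7.2 closing remark), padic-automorphic-induction (variant),
forall-iota-hidden-arithmeticity (variant), versal-torsor-depotentialisation,
analytic-descent-pole-tolerant-converse.
Nearest prior art: BarnetlambEtAl2014 §4.2–§5.5 (potential automorphy + solvable descent given
existence of r_ℓ(π); compatible systems from potential automorphy via patching over subfields with
solvable co-group), Taylor2006 Thm A (insoluble descent gives only meromorphy),  [refs: 10.4310/mrl.2002.v9.n4.a9, 2603.19768, 2605.03519, 2502.10799, doi:10.4310/mrl.2002.v9.n4.a9, BarnetlambEtAl2014, Taylor2006, ACCGHLNSTT2023, Sorensen2020, Calegari2023]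

Barriers (technique_class: automorphy-lifting patching solvable-base-change descent): BARRIERS (technique_class: automorphy-lifting patching solvable-base-change cyclic-base-change
automorphic-induction; all 13 catalogued Langlands entries checked):
- Literature.Barriers.Langlands.NonRegularWeightBarrier: APPLIES to AutToGalCM (irregular
L-algebraic π over CM fields) and, through strong purity of induced weights, to AscentAutToGal; NOT
evaded — the route's bet is that the irregular sector over CM fields is the single black hole worth
isolating (every other field funnels into it), to be attacked inside routes CMFern (p-adic density +
classicality) and by the irregular-sector cards; the barrier's own evasion (coherent cohomology for
limits of discrete series) covers only part of the sector.
- Literature.Barriers.Langlands.ShimuraVarietyRealizationBarrier: APPLIES to (A) over fields neither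
TR nor CM; evaded-by-relocation in AscentAutToGal (no variety over F is used: induce to F^tr, where
the barrier's evasions HLTT/Scholze live), at the price of irregular weight over F^tr (see above)
and of the inert-place descent ambiguity.
- Literature.Barriers.Langlands.TaylorWilesNumericalCoincidence and
Literature.Barriers.Langlands.TaylorWilesNumericalCoincidenceNarrow: APPLY to PotentialAutomorphy
for non-polarizable ρ (defect l₀>0); evasion = positive-defect patching (Calegari–Geraghty,
ACCGHLNSTT2023) as far as it goes; beyond generic regular ρ over CM the crux does not evade them.
- Literature.Barriers.Langlands.PatchingLocalComponentBarrier: APPLIES to PotentialAutomo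

Novelty grade: variant — ROUTE REVIEW (refuter, 2026-08-15). Novelty VARIANT: the BLGGT/CHT/ACC+ automorphy-lifting programme re-cut crux-first, setting widened to all weights/all number fields; no new mechanism, no new combination (planner agrees). The claimed design delta — 'descent duality ⇒ (B)-side cruxes conditional o (refuter refuter-rreview-route-Langlands-LiftDesc-c79f9957-0, 2026-08-15T11:19:12Z; prior: BarnetLambGeeGeraghtyTaylor2014 (BLGGT) §4.2–5.5: potential automorphy + solvable descent given r_ℓ(π), Taylor2006 Thm A: insoluble descent yields meromorphy only, ACCGHLNSTT2023 §6: potential automorphy GL_n over CM, ArthurClozel1989 Ch.3 Thm 4.2/6.2 (prime cyclic BC/descent/AI), held, p.7 read, Sorensen2020 patching lemma (tree: PatchingLemma), Rajan MRL 9 (2002) doi:10.4310/mrl.2002.v9.n4.a9, C)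

History (route lifecycle, newest last):
- 2026-08-16T02:57:42Z · rev 11: restated PotentialAutomorphy (stmt-Langlands-1060) — repair rev 11: PotentialAutomorphy (stmt-Langlands-1060) refuted-misstated ON PAPER (route review c79f9957 SUSPECT_1060.md; g44-41; crux-attack rattack-1060 CRU (planner-rrefute-Langlands-LiftDescend-stmt-Lan-dc794824-0)
- 2026-08-24T20:46:56Z · DORMANT — reconciler: no traction for 7.1 d (last activity statement-attached at 2026-08-17T18:45:39Z); parked, not closed — `ledger route dormant route-Langlands-LiftDes (operator:999:1995293)
- 2026-08-24T22:03:37Z · REACTIVATED — reconciler: reactivated — activity route-repaired at 2026-08-24T21:04:19Z after parking at 2026-08-24T20:46:56Z (operator:999:2695070)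
- 2026-08-27T15:10:19Z · STALE-VERDICT (tier-A confirmation): L344: Application type mismatch: The argument   R has type   ReciprocityData F of sort `Type 1` but is expected to have type   Nonempty (ReciprocityData F) of s (operator:gate5)

sub-problem: Langlands · status: open · opened planner-plan-Langlands-0 2026-08-15T10:49:19Z · rev 13 · ledger route-Langlands-LiftDescend
GENERATED by the gate from the ledger (D-0016/17). Provers cite these decls: `theorem foo : Summit.Langlands.Langlands.Theses.LiftDescend.<Decl> := …` in Summits/Langlands/Langlands/Theorems/<Name>.lean.
-/

namespace Summit.Langlands.Langlands.Theses.LiftDescend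

open scoped BigOperators Topology Manifold Classical MeasureTheory ProbabilityTheory Matrix InnerProductSpace ComplexConjugate ContinuousMap
open Filter Set Function TopologicalSpace MeasureTheory

attribute [summit_statement] _root_.Langlands

/-- item stmt-Langlands-1059 · crux · rank 2 · open · by planner
why it might fail: Irregular L-algebraic π over CM F (BC of λ=1/4 Maass forms; weight-one type in rank n) occur in no Betti/coherent cohomology: no ρ_{π,ι} for any ι, not even algebraic Satake parameters, is known (Scholze2015 Thm 1.0.4/HLTT are regular-only; Calegari2023 §12); LGC at v∣ℓ open even for regular π.
sources: Scholze2015, Calegari2023, HarrisLanTaylorThorneRMS2016, VarmaFMS2024, BuzzardGeeLMS2014, arXiv:1306.2070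
[crux] Direction (A) over CM fields F for ALL L-algebraic cuspidal π of GL_n(𝔸_F) (any infinity
type), with the summit's full local–global compatibility: ∃R ∀n>0 ∀hcpt, AutomorphicToGalois n R
hcpt. Regular algebraic π: HLTT/Scholze (+Varma at v∤ℓ; A'Campo / Caraiani–Newton at v∣ℓ; monodromy
operator open in general). The OPEN CORE is the irregular sector (weight-one type in rank n, base
changes of Maass λ=1/4 forms, abelian-threefold-type weights) where no cohomological/p-adic
realisation is known; every mixed-signature field funnels into it (AscentAutToGal). Shared with
route CMFern. -/
@[route_item "route-Langlands-LiftDescend", crux]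
def AutToGalCM : Prop :=
  ∀ (F : Type) [Field F] [NumberField F], NumberField.IsCMField F → ∃ R : ReciprocityData F, ∀ n : ℕ, 0 < n → ∀ hcpt : Literature.NumberTheory.Automorphic.isCompact_glFiniteIntegralLevel n F, AutomorphicToGalois n R hcpt

-- earlier PotentialAutomorphy (stmt-Langlands-1060, replaced 2026-08-16T02:57:42Z -> stmt-Langlands-14091): retired by None — ∀ (F : Type) [Field F] [NumberField F] (R : ReciprocityData F), (∀ n : ℕ, 0 < n → ∀ hcpt : Literature.NumberTheory.Automorphic.isCompact_glFiniteIntegralLevel n F, AutomorphicToGalois n R hcpt) → ∀ (n : ℕ), 0 < n → ∀ (ℓ : ℕ) [Fact ℓ.Prime] (ι : PadicAlgCl ℓ ≃+* ℂ) (ρ : Litera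
/-- item stmt-Langlands-14091 · crux · rank 3 · open · by planner
why it might fail: Every potential-automorphy engine needs F′ CM/TR, REGULAR HT weights, big residual image (BLGGT Thm 4.5.1: polarizable, pot. diagonalizable; ACC+ Thm 6.1.1: decomposed generic); mixed-signature F has no CM/TR extension; even icosahedral ρ/ℚ, genus-3 Jacobians out of reach (Calegari2023 §12).
sources: BarnetlambEtAl2014, ACCGHLNSTT2023, Taylor2006, BoxerEtAl2021, Calegari2023, Thorne2012
[crux] POTENTIAL AUTOMORPHY, JOINTLY ∃R-PINNED (repair rev 11 of this item, refuted-misstated on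
paper by three refuters: the old ∀R-form "∀ R, (A)_R → R-geometric ⇒ potentially automorphic" let a
permissive placeholder p-adic Hodge datum R₂ — pst period ring B_dR[u^±] twisted by ⟨κ⟩^s, s ∈ ℤ_ℓ∖ℚ
— inherit (A) from the genuine datum while making the non-Hodge–Tate character ⟨κ⟩^{-s}
"R₂-geometric", matched by no L-algebraic GL_1 π′ over any F′; evidence SUSPECT_1060.md,
CRUXATTACK_1060.md). New shape C′₁ (summit-shaped, as CMFern rev 7): for every number field F, IF
direction (A) holds over F for some reciprocity data, THEN there are reciprocity data R over F such
that (i) (A) holds for R — the lower pin of the placeholder-typed notion "R-geometric" — AND (ii)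
every irreducible R-geometric ρ : Γ_F → GL_n(ℚ̄_ℓ) is weakly cuspidal-automorphic (a.e.
Satake–Frobenius matching with an L-algebraic cuspidal π′ of GL_n over F′) over SOME finite Galois
extension F′/F on which ρ stays irreducible — the upper pin. R is chosen together with both pins,
exactly as the summit's ∃𝓡((A)∧(B)), so neither a permissive nor a strict junk datum witnesses the
item; truth-wise it is implied by the summit -/
@[route_item "route-Langlands-LiftDescend", crux]
def PotentialAutomorphy : Prop :=
  ∀ (F : Type) [Field F] [NumberField F], (∃ R₀ : ReciprocityData F, ∀ n : ℕ, 0 < n → ∀ hcpt : Literature.NumberTheory.Automorphic.isCompact_glFiniteIntegralLevel n F, AutomorphicToGalois n R₀ hcpt) → ∃ R : ReciprocityData F, (∀ n : ℕ, 0 < n → ∀ hcpt : Literature.NumberTheory.Automorphic.isCompact_glFiniteIntegralLevel n F, AutomorphicToGalois n R hcpt) ∧ ∀ (n : ℕ), 0 < n → ∀ (ℓ : ℕ) [Fact ℓ.Prime] (ι : PadicAlgCl ℓ ≃+* ℂ) (ρ : Literature.NumberTheory.GaloisRepresentations.FramedGaloisRep F (PadicAlgCl ℓ) n), ρ.toGaloisRep.IsIrreducible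 → IsGeometricFramed R ρ → ∃ (F' : Type) (_ : Field F') (_ : NumberField F') (_ : Algebra F F') (_ : IsGalois F F'), (ρ.restrictField F').toGaloisRep.IsIrreducible ∧ ∃ (hcpt' : Literature.NumberTheory.Automorphic.isCompact_glFiniteIntegralLevel n F') (π' : Literature.NumberTheory.Automorphic.CuspidalAutomorphicRepData n F' hcpt'), π'.1.IsLAlgebraic ∧ ∀ᶠ w : IsDedekindDomain.HeightOneSpectrum (NumberField.RingOfIntegers F') in cofinite, SatakeFrobCompatibleAt ι π'.1 (ρ.restrictField F') w

/-- item stmt-Langlands-1061 · crux · rank 4 · open · by planner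
why it might fail: Off TR∪CM no cohomology realises π (ShimuraVarietyRealizationBarrier); restriction of scalars needs AI along non-normal F/F^tr — insoluble (S₅-quintic) closure = non-solvable functoriality (Getz2012, conj.) — in IRREGULAR weight over F^tr; solvable descent only up to an invariant character (Rajan).
sources: ArthurClozelAMS120, doi:10.4310/mrl.2002.v9.n4.a9, Getz2012Nonsolvable, arXiv:1701.01766, Taylor1994, BoxerEtAl2021
[crux] (A) over every totally real or CM field (all weights) ⇒ (A) over every number field.
Mechanism (card conjugation-solvable-fields; route BaseFieldAscent): restriction of scalars —
automorphic induction of π⊗χ along F/F^tr (Arthur–Clozel along cyclic prime layers when the Galois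
closure of F over its maximal totally real subfield F^tr is solvable; simple-group AI otherwise),
Galois representations over F^tr in IRREGULAR weight (strong purity: AI(π) has every HT value with
multiplicity ≥[F:F₁]), then de-induction by Clifford theory + patching over twists (Taylor1994, Mok,
BCGP §2.7 for n=2) and descent at inert places (Rajan MRL 2002: ambiguity up to an invariant
character). -/
@[route_item "route-Langlands-LiftDescend", crux]
def AscentAutToGal : Prop :=
  (∀ (F : Type) [Field F] [NumberField F], (NumberField.IsTotallyReal F ∨ NumberField.IsCMField F) → ∃ R : ReciprocityData F, ∀ n : ℕ, 0 < n → ∀ hcpt : Literature.NumberTheory.Automorphic.isCompact_glFiniteIntegralLevel n F, AutomorphicToGalois n R hcpt) → ∀ (F : Type) [Field F] [NumberField F], ∃ R : ReciprocityData F, ∀ n : ℕ, 0 < n → ∀ hcpt : Literature.NumberTheory.Automorphic.isCompact_glFiniteIntegralLevel n F, AutomorphicToGalois n R hcpt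

/-- item stmt-Langlands-1062 · crux · rank 5 · open · by planner
why it might fail: Insoluble Gal(F′/F) (non-abelian simple section): no base change, descent or AI across such a layer — Brauer + solvable BC give only virtual automorphy/meromorphy (Taylor2006 Thm A; BLGGT §5); Getz's Ã₅ identities are conditional (conj-1/conj-solv); (A)/F turns it into non-solvable AI, equally open.
sources: Taylor2006, BarnetlambEtAl2014, Getz2012Nonsolvable, arXiv:1701.01766, GetzHahn2024, ArthurClozelAMS120
[crux] Descent of weak cuspidal automorphy along an ARBITRARY finite Galois extension F′/F for
irreducible geometric ρ staying irreducible over F′, GIVEN (A) over F for the same data (the BLGGT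
argument shows (A) over the base is the right hypothesis: Π^σ≅Π ⇒ Π=BC(π) ⇒ ρ|≅ρ_π| ⇒ ρ≅ρ_π⊗χ).
Solvable Gal(F′/F): theorem-level, filed as support SolvableDescentOfAutomorphy. Insoluble
Gal(F′/F): needs non-solvable base-change descent for GL_n (Getz) or an analytic
Brauer-quotient/converse-theorem substitute (cards analytic-descent-pole-tolerant-converse,
versal-torsor-depotentialisation). -/
@[route_item "route-Langlands-LiftDescend", crux]
def DescentOfAutomorphy : Prop :=
  ∀ (F : Type) [Field F] [NumberField F] (R : ReciprocityData F), (∀ n : ℕ, 0 < n → ∀ hcpt : Literature.NumberTheory.Automorphic.isCompact_glFiniteIntegralLevel n F, AutomorphicToGalois n R hcpt) → ∀ (n : ℕ), 0 < n → ∀ (ℓ : ℕ) [Fact ℓ.Prime] (ι : PadicAlgCl ℓ ≃+* ℂ) (ρ : Literature.NumberTheory.GaloisRepresentations.FramedGaloisRep F (PadicAlgCl ℓ) n), ρ.toGaloisRep.IsIrreducible → IsGeometricFramed R ρ → (∃ (F' : Type) (_ : Field F') (_ : NumberField F') (_ : Algebra F F') (_ : IsGalois F F'), (ρ.restrictField F').toGaloisRep.IsIrreducible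 ∧ ∃ (hcpt' : Literature.NumberTheory.Automorphic.isCompact_glFiniteIntegralLevel n F') (π' : Literature.NumberTheory.Automorphic.CuspidalAutomorphicRepData n F' hcpt'), π'.1.IsLAlgebraic ∧ ∀ᶠ w : IsDedekindDomain.HeightOneSpectrum (NumberField.RingOfIntegers F') in cofinite, SatakeFrobCompatibleAt ι π'.1 (ρ.restrictField F') w) → ∀ hcpt : Literature.NumberTheory.Automorphic.isCompact_glFiniteIntegralLevel n F, ∃ π : Literature.NumberTheory.Automorphic.CuspidalAutomorphicRepData n F hcpt, π.1.IsLAlgebraic ∧ ∀ᶠ v : IsDedekindDomain.HeightOneSpectrum (NumberField.RingOfIntegers F) in cofinite, SatakeFrobCompatibleAt ι π.1 ρ v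

/-- item stmt-Langlands-10478 · support · rank 9 · closed · proved by Summit.Langlands.Langlands.Theorems.liftDescend_quasiCharKernelOpen_proof (prover) · by planner
[support] needs-fact (route-repair g4 2026-08-15, cone guardrail; audit alias): the named fact
`Literature.NumberTheory.Automorphic.isOpen_ker_quasiChar` (quasi-characters of Fˣ have open kernel;
BushnellHenniart2006 §1.5) is a field (`hqc`) of every `LocalLanglandsDatum`, hence of every
`ReciprocityData F` the route's items quantify over. It is DISCHARGED in tree
(`isOpen_ker_quasiChar_holds`, LocalLanglandsGLProofs.lean:367, now imported by this route file) but
the gate's cone audit (`#h21_route_deps`, H21.Audit.statesExactly) does not see the witness: its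
binders are `[Field F] [ValuativeRel F] [TopologicalSpace F]` while the def's are `[Field F]
[TopologicalSpace F] [ValuativeRel F]`, so the fact still counts in deps.unproved (2 left: this and
exists_galoisRep_of_regularAlgebraic). DELIVERABLE for whoever takes this item: (1) the one-line
Literature alias, proposed into Literature/NumberTheory/Automorphic/LocalLanglandsGLProofs.lean
(namespace Literature.NumberTheory.Automorphic): `theorem isOpen_ker_quasiChar.holds {F : Type*}
[Field F] [TopologicalSpace F] [ValuativeRel F] [IsNonarchimedeanLocalField F] :
isOpen_ker_quasiChar (F := F) := isOpen_ker_quasiChar_holds` (verified -/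
@[route_item "route-Langlands-LiftDescend"]
def QuasiCharKernelOpen : Prop :=
  ∀ (F : Type) [Field F] [TopologicalSpace F] [ValuativeRel F] [IsNonarchimedeanLocalField F], Literature.NumberTheory.Automorphic.isOpen_ker_quasiChar (F := F)

-- `QuasiCharKernelOpen` holds: proved by `Summit.Langlands.Langlands.Theorems.liftDescend_quasiCharKernelOpen_proof` (its module imports this route file, so no `_holds` link can be stated here).

/-- item stmt-Langlands-1063 · support · rank 9 · open · by planner
sources: Sorensen2020, HarrisLanTaylorThorneRMS2016, ArthurClozelAMS120
[support] (A) over all CM fields ⇒ (A) over all totally real fields: for π over TR F base-change to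
the imaginary-quadratic composita FK_i (Arthur–Clozel; cuspidal for all but finitely many K_i), take
ρ_i from (A) over FK_i, patch with Sorensen's lemma (tree:
Literature.NumberTheory.GaloisRepresentations.PatchingLemma / SorensenPatching; {FK_i} is
S-general), transfer local–global compatibility and de Rhamness at v from a K_i in which v splits
(F_v = (FK_i)_w), irreducibility from a restriction, uniqueness by Chebotarev. Theorem-level;
Lean-heavy (transport of ReciprocityData along F_v ≅ (FK_i)_w). -/
@[route_item "route-Langlands-LiftDescend", crux]
def AutToGalCMtoTR : Prop :=
  (∀ (F : Type) [Field F] [NumberField F], NumberField.IsCMField F → ∃ R : ReciprocityData F, ∀ n : ℕ, 0 < n → ∀ hcpt : Literature.NumberTheory.Automorphic.isCompact_glFiniteIntegralLevel n F, AutomorphicToGalois n R hcpt) → ∀ (F : Type) [Field F] [NumberField F], NumberField.IsTotallyReal F → ∃ R : ReciprocityData F, ∀ n : ℕ, 0 < n → ∀ hcpt : Literature.NumberTheory.Automorphic.isCompact_glFiniteIntegralLevel n F, AutomorphicToGalois n R hcpt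

/-- item stmt-Langlands-1064 · support · rank 9 · open · by planner
sources: doi:10.2977/prims/31, BarnetlambEtAl2014, ArthurClozelAMS120, doi:10.4310/mrl.2002.v9.n4.a9, doi:10.1515/form.10.2.175, Getz2012Nonsolvable
[support] The solvable case of DescentOfAutomorphy (IsSolvable (F′ ≃ₐ[F] F′)): reduce to cyclic
prime layers; strong multiplicity one + Arthur–Clozel cyclic descent (tree:
ArthurClozel1989_cuspidal_descent, exists_baseChange_cyclic) + (A) over F +
Chebotarev/Brauer–Nesbitt (tree: PatchingLemma.exists_conj_of_trace_eq) + Clifford theory ⇒ ρ ≅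
ρ_π⊗χ with π⊗χ cuspidal (CuspidalAutomorphicRepData.twist, CFT for χ via
exists_isClassFieldCharacter). The printed argument of BLGGT §5 / CHT §4; theorem-level. -/
@[route_item "route-Langlands-LiftDescend"]
def SolvableDescentOfAutomorphy : Prop :=
  ∀ (F : Type) [Field F] [NumberField F] (R : ReciprocityData F), (∀ n : ℕ, 0 < n → ∀ hcpt : Literature.NumberTheory.Automorphic.isCompact_glFiniteIntegralLevel n F, AutomorphicToGalois n R hcpt) → ∀ (n : ℕ), 0 < n → ∀ (ℓ : ℕ) [Fact ℓ.Prime] (ι : PadicAlgCl ℓ ≃+* ℂ) (ρ : Literature.NumberTheory.GaloisRepresentations.FramedGaloisRep F (PadicAlgCl ℓ) n), ρ.toGaloisRep.IsIrreducible → IsGeometricFramed R ρ → (∃ (F' : Type) (_ : Field F') (_ : NumberField F') (_ : Algebra F F') (_ : IsGalois F F'), IsSolvable (F' ≃ₐ[F] F') ∧ (ρ.restrictField F').toGaloisRep.IsIrreducible ∧ ∃ (hcpt' : Literature.NumberTheory.Automorphic.isCompact_glFiniteIntegralLevel n F') (π' : Literature.NumberTheory.Automorphic.CuspidalAutomorphicRepData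 n F' hcpt'), π'.1.IsLAlgebraic ∧ ∀ᶠ w : IsDedekindDomain.HeightOneSpectrum (NumberField.RingOfIntegers F') in cofinite, SatakeFrobCompatibleAt ι π'.1 (ρ.restrictField F') w) → ∀ hcpt : Literature.NumberTheory.Automorphic.isCompact_glFiniteIntegralLevel n F, ∃ π : Literature.NumberTheory.Automorphic.CuspidalAutomorphicRepData n F hcpt, π.1.IsLAlgebraic ∧ ∀ᶠ v : IsDedekindDomain.HeightOneSpectrum (NumberField.RingOfIntegers F) in cofinite, SatakeFrobCompatibleAt ι π.1 ρ v

/-- item stmt-Langlands-1065 · support · rank 9 · closed · proved by Summit.Langlands.Langlands.Theorems.SmithKummerSeedCyclicPrimeDescent.weakToStrongGalToAut_proof (prover) · by planner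
sources: BuzzardGeeLMS2014, SerreAbelianLadic1968
[support] Glue: given (A) w.r.t. R and weak (B) (a.e. SatakeFrobCompatibleAt), deduce
GaloisToAutomorphic w.r.t. the same R — ρ and ρ_π are irreducible with equal Frobenius polynomials
a.e. (uniqueness of Satake parameters) ⇒ conjugate (Chebotarev density + Brauer–Nesbitt) ⇒ transport
Corresponds along FramedRep.conj (isUnramifiedAt_conj_iff, charpoly invariance,
PstWeilDeligneData.conj, class-level HasFrobSemisimpleClass). Provable now modulo a
Chebotarev-density named fact for ℓ-adic representations. -/
@[route_item "route-Langlands-LiftDescend", crux]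
def WeakToStrongGalToAut : Prop :=
  ∀ (F : Type) [Field F] [NumberField F] (R : ReciprocityData F), (∀ n : ℕ, 0 < n → ∀ hcpt : Literature.NumberTheory.Automorphic.isCompact_glFiniteIntegralLevel n F, AutomorphicToGalois n R hcpt) → (∀ (n : ℕ), 0 < n → ∀ (ℓ : ℕ) [Fact ℓ.Prime] (ι : PadicAlgCl ℓ ≃+* ℂ) (ρ : Literature.NumberTheory.GaloisRepresentations.FramedGaloisRep F (PadicAlgCl ℓ) n), ρ.toGaloisRep.IsIrreducible → IsGeometricFramed R ρ → ∀ hcpt : Literature.NumberTheory.Automorphic.isCompact_glFiniteIntegralLevel n F, ∃ π : Literature.NumberTheory.Automorphic.CuspidalAutomorphicRepData n F hcpt, π.1.IsLAlgebraic ∧ ∀ᶠ v : IsDedekindDomain.HeightOneSpectrum (NumberField.RingOfIntegers F) in cofinite, SatakeFrobCompatibleAt ι π.1 ρ v) → ∀ n : ℕ, 0 < n → ∀ hcpt : Literature.NumberTheory.Automorphic.isCompact_glFiniteIntegralLevel n F, GaloisToAutomorphic n R hcpt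

-- `WeakToStrongGalToAut` holds: proved by `Summit.Langlands.Langlands.Theorems.SmithKummerSeedCyclicPrimeDescent.weakToStrongGalToAut_proof` (its module imports this route file, so no `_holds` link can be stated here).

/-- item stmt-Langlands-1066 · support · rank 9 · closed · proved by Summit.Langlands.Langlands.Theorems.lArithmeticOfAutToGal_proof (prover) · by planner
sources: BuzzardGeeLMS2014, Deligne1980, Scholze2015
[support] Hidden arithmeticity (card forall-iota-hidden-arithmeticity, H1): AutomorphicToGalois n R
hcpt — quantified over ALL ring isomorphisms ι : ℚ̄_ℓ ≃ ℂ — implies that the Satake parameters of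
every L-algebraic cuspidal π are algebraic numbers at almost all places (compact Galois image ⇒
Frobenius eigenvalues are ℓ-adic units; Aut(ℂ/ℚ) is transitive on transcendentals (Steinitz) so a
transcendental parameter could be sent to a non-unit). Provable now from Mathlib transcendence bases
+ exists_hasQlModel. Records that Buzzard–Gee L-arithmeticity is a CONJUNCT of the typed summit:
every irregular-sector (A)-engine must deliver algebraicity. -/
@[route_item "route-Langlands-LiftDescend"]
def LArithmeticOfAutToGal : Prop :=
  ∀ (F : Type) [Field F] [NumberField F] (R : ReciprocityData F) (n : ℕ) (hcpt : Literature.NumberTheory.Automorphic.isCompact_glFiniteIntegralLevel n F), AutomorphicToGalois n R hcpt → ∀ π : Literature.NumberTheory.Automorphic.CuspidalAutomorphicRepData n F hcpt, π.1.IsLAlgebraic → ∀ᶠ v : IsDedekindDomain.HeightOneSpectrum (NumberField.RingOfIntegers F) in cofinite, ∀ α : Multiset ℂ, π.1.HasSatakeParamAt v α → ∀ a ∈ α, IsAlgebraic ℚ a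

-- `LArithmeticOfAutToGal` holds: proved by `Summit.Langlands.Langlands.Theorems.lArithmeticOfAutToGal_proof` (its module imports this route file, so no `_holds` link can be stated here).

/-- item stmt-Langlands-23603 · support · rank 9 · open · by planner
sources: Henniart1993, HenniartBSMF2002, Shalika1974, HarrisTaylorAMS2001, BuzzardGeeLMS2014
[support] [piece R of the L∤R split; verbatim the registered stub
`…CompatibilityAwayFromLR.Birth.stub_recRigidity`; WEAKER (L∤R forces it: landed
`Theorems/CompatibilityAwayFromLR/Negative/RigidOfCompatibilityAwayFromLR.lean`,
`recGL_eq_of_compatibilityAwayFromLR`); leaf ATTACKABLE closed-mod-print: conclusion of the landed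
glue `ReciprocityUpToIrreducibilityR.stub_recRigidityLAlg_of_genericRigidity ∘
stub_genericRigidity_of_facts` from five local facts (localLanglands_gl, generic preimages, Henniart
2002 Thm 1.7(a) / 1.6(b), invariant measures); critic: CLEARED decomp-langlands-crit-1-g0 0
2026-08-30T01:15:58Z (pub/decomp-langlands/STATUS.md; CRITIC-LEDGER.md row 01:15:58Z)] any two
pinned reciprocity data give the same class rec_v(π_v) to every local component of every L-algebraic
cuspidal π (Henniart's uniqueness of rec_v on generic classes; local components of cusp forms are
generic by Shalika). [difficulty: provable-now] -/
@[route_item "route-Langlands-LiftDescend", crux]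
def RecRigidity : Prop :=
  ∀ (K : Type) [Field K] [NumberField K] (Rec Rec' : ReciprocityData K) (n : ℕ) (hcpt : Literature.NumberTheory.Automorphic.isCompact_glFiniteIntegralLevel n K), 0 < n → ∀ (π : Literature.NumberTheory.Automorphic.CuspidalAutomorphicRepData n K hcpt), π.1.IsLAlgebraic → ∀ (v : IsDedekindDomain.HeightOneSpectrum (NumberField.RingOfIntegers K)) (πv : Literature.NumberTheory.Automorphic.SmoothIrrep (Matrix.GeneralLinearGroup (Fin n) (v.adicCompletion K))), π.1.HasLocalComponentAt v πv.ρ → (Rec.llc v).recGL n (Literature.NumberTheory.Automorphic.IrrClass.mk πv) = (Rec'.llc v).recGL n (Literature.NumberTheory.Automorphic.IrrClass.mk πv)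

/-- item stmt-Langlands-1067 · assembly · rank 1 · open · by planner
sources: BuzzardGeeLMS2014
[assembly] AutToGalCM → AutToGalCMtoTR → AscentAutToGal → PotentialAutomorphy → DescentOfAutomorphy
→ WeakToStrongGalToAut → Langlands. Pure logic: (A) for every F from the first three; given the R of
(A), apply PotentialAutomorphy, DescentOfAutomorphy, WeakToStrongGalToAut to get (B) w.r.t. the same
R; then GlobalLanglandsCorrespondenceGLn = (A) ∧ (B). A sketch proof (`liftDescend_assembly`)
compiles in the planner's Sketch.lean. -/
@[route_item "route-Langlands-LiftDescend"]
def Assembly : Prop :=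
  AutToGalCM → AutToGalCMtoTR → AscentAutToGal → PotentialAutomorphy → DescentOfAutomorphy → WeakToStrongGalToAut → Langlands

/-! D-0027 §2.1 — DECIDING THEOREM (planner-authored via `route open/edit --closes-file`; by operator:999:2471332 2026-08-31T07:34:14Z):
its hypotheses are this route's items and its conclusion the sub-problem Statement (glue_lint), and it elaborates with this file. -/

/-- D-0027 §2.1 deciding theorem of route LiftDescend — REPAIRED 2026-08-31 against the summit as
re-typed 2026-08-16 (`∀ F, Nonempty (ReciprocityData F) ∧ ∀ 𝓡 n, 0 < n → ∀ hcpt, (A) ∧ (B)`; the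
rev-12 text was written for the older `∃ 𝓡` shape and no longer elaborated: L345 `And.intro R`,
`⟨…⟩` on the `∀ hcpt` binder). Pure logic over the six load-bearing items plus the shared support
item `RecRigidity` (= stmt-Langlands-23603, wanted by RootDecomp1 / RetentionCarving / PurityCarving /
IwahoriBlockSplit / SphericalRigiditySplit): (A) over CM fields (`AutToGalCM`) ⇒ (A) over totally
real fields (`AutToGalCMtoTR`) ⇒ (A) over every number field for some reciprocity data
(`AscentAutToGal`); `PotentialAutomorphy` yields reciprocity data `R` over `F` carrying (A) TOGETHER
WITH potential weak automorphy of every irreducible `R`-geometric `ρ`; for that same `R`, potential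
weak automorphy descends (`DescentOfAutomorphy`) and weak (B) + (A) upgrade to (B)
(`WeakToStrongGalToAut`) — reciprocity for ONE pinned datum `R`, whence `Nonempty (ReciprocityData F)`.
TRANSFER to EVERY pinned datum `𝓡`: `IsGeometricFramed` and the `v ∣ ℓ` clause of
`LocalGlobalCompatibleAt` read the PINNED Fontaine datum (`ReciprocityData.pst` ignores its argument,
so they agree definitionally), the Satake clause does not mention the datum, and the one
datum-dependent clause `rℂ.HasFrobSemisimpleClass (rec_v(π_v))` is rewritten along `RecRigidity`
(any two pinned data give the same class to every local component of every L-algebraic cuspidal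
`π`; Henniart's uniqueness on generic classes + Shalika) — in both directions, so the uniqueness
clause of (A) transfers too. Only `Summits.Langlands.Langlands.Statement`-level definitions are
unfolded; no new import. The support items `SolvableDescentOfAutomorphy`, `LArithmeticOfAutToGal`,
`QuasiCharKernelOpen` and the bookkeeping `Assembly` are not hypotheses. -/
@[closes "route-Langlands-LiftDescend"] theorem closes (hCM : AutToGalCM) (hTR : AutToGalCMtoTR) (hAsc : AscentAutToGal)
    (hPot : PotentialAutomorphy) (hDesc : DescentOfAutomorphy) (hW2S : WeakToStrongGalToAut)
    (hRR : RecRigidity) : _root_.Langlands := by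
  -- (A) over every totally real or CM field
  have hTRCM : ∀ (F : Type) [Field F] [NumberField F],
      (NumberField.IsTotallyReal F ∨ NumberField.IsCMField F) →
        ∃ R : ReciprocityData F, ∀ n : ℕ, 0 < n →
          ∀ hcpt : Literature.NumberTheory.Automorphic.isCompact_glFiniteIntegralLevel n F,
            AutomorphicToGalois n R hcpt := by
    intro F _ _ h
    rcases h with h | h
    · exact hTR hCM F h
    · exact hCM F h
  -- (A) over every number field for some data (ascent); PotentialAutomorphy re-chooses data `R`
  -- carrying (A) together with potential weak automorphy; descent and weak ⇒ strong for that `R`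
  intro F _ _
  obtain ⟨R, hA, hPA⟩ := hPot F (hAsc hTRCM F)
  refine ⟨⟨R⟩, fun Rec n hn hcpt => ?_⟩
  have hB : GaloisToAutomorphic n R hcpt := by
    refine hW2S F R hA ?_ n hn hcpt
    intro m hm ℓ _ ι ρ hirr hgeo hcpt'
    exact hDesc F R hA m hm ℓ ι ρ hirr hgeo (hPA m hm ℓ ι ρ hirr hgeo) hcpt'
  -- transfer of `Corresponds` between any two pinned data along `RecRigidity`
  have hcorrT : ∀ (R₁ R₂ : ReciprocityData F) (ℓ : ℕ) [Fact ℓ.Prime] (ι : PadicAlgCl ℓ ≃+* ℂ)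
      (π : Literature.NumberTheory.Automorphic.CuspidalAutomorphicRepData n F hcpt), π.1.IsLAlgebraic →
      ∀ ρ : Literature.NumberTheory.GaloisRepresentations.FramedGaloisRep F (PadicAlgCl ℓ) n,
        Corresponds R₁ ι π.1 ρ → Corresponds R₂ ι π.1 ρ := by
    intro R₁ R₂ ℓ _ ι π hπ ρ h
    refine ⟨h.1, fun v => ?_⟩
    obtain ⟨πv, r, rℂ, hloc, haway, habove, htrans, hclass⟩ := h.2 v
    refine ⟨πv, r, rℂ, hloc, haway, habove, htrans, ?_⟩
    rw [← hRR F R₁ R₂ n hcpt hn π hπ v πv hloc]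
    exact hclass
  refine ⟨?_, ?_⟩
  · -- (A) for `Rec`
    intro π hπ ℓ _ ι
    obtain ⟨ρ, hirr, hgeo, hcorr, huniq⟩ := hA n hn hcpt π hπ ℓ ι
    exact ⟨ρ, hirr, hgeo, hcorrT R Rec ℓ ι π hπ ρ hcorr,
      fun ρ' h' => huniq ρ' (hcorrT Rec R ℓ ι π hπ ρ' h')⟩
  · -- (B) for `Rec`
    intro ℓ _ ι ρ hirr hgeo
    obtain ⟨π, hπ, hcorr⟩ := hB ℓ ι ρ hirr hgeo
    exact ⟨π, hπ, hcorrT R Rec ℓ ι π hπ ρ hcorr⟩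

end Summit.Langlands.Langlands.Theses.LiftDescend
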